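import Literature.Geometry.Lorentzian.TwoParameterCurvature
import Literature.Geometry.Lorentzian.SecondFundamentalFormSymm
import Literature.Geometry.Lorentzian.ChartLaplacian
import Literature.Geometry.Lorentzian.GeodesicSpeed
import Literature.Geometry.Lorentzian.LeviCivitaProofs
import HarnessLib

/-!
# The Gauss formula, tangential part: `g(D̄_{∂_d}(df ∂ₐ), df ∂_b) = (f^*g)(∇_{∂_d} ∂ₐ, ∂_b)`

O'Neill 1983, Ch. 4, Lemma 3 (p. 98): for a semi-Riemannian submanifold `M ⊂ M̄` with
Levi-Civita connections `D`, `D̄`, and `V, W` tangent to `M`, `D_V W = tan D̄_V W` — proved from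
the Koszul formula (both sides satisfy it on tangent fields); along curves this is the tangential
part of Prop. 8 (p. 104), `Ẏ = Y' + II(α', Y)`. This file proves the identity in the form needed
for the Gauss equation of an immersed hypersurface in the tree's setting — an arbitrary smooth
spacelike immersion `f : N → (M, g)` with induced metric `f^*g` (`inducedMetric`), fields along
`f` differentiated along curves by `covariantDerivAlong` of the ambient Levi-Civita connection —
and on the coordinate data of a fixed chart `φ` of `N` at `y₀` (coordinate frame `∂ₐ` of `TN`,
coordinate lines `t ↦ φ⁻¹(φ p + t e_d)` through the points `p` of the chart domain):

* `val_covariantDerivAlong_mfderiv_localFrame_chartLine` — **Lemma 4.3 on coordinate fields**: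
  `g(D̄_{∂_d}(df ∂ₐ), df ∂_b)(p) = (f^*g)(∇_{∂_d} ∂ₐ, ∂_b)(p)` for all `p` in the chart domain and
  all indices, `D̄_{∂_d}(df ∂ₐ)` the covariant derivative at `0` of `t ↦ df(∂ₐ)` along the image
  in `M` of the `d`-th coordinate line, `∇` the Levi-Civita connection of `f^*g`.

The proof is O'Neill's: `2(f^*g)(∇_{∂_d}∂ₐ, ∂_b) = ∂_d G_{ab} + ∂ₐ G_{bd} − ∂_b G_{da}` by the
Koszul formula on coordinate fields (`two_mul_val_leviCivita_localFrame`, `ChartLaplacian.lean`),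
and the right-hand side is computed from the ambient side by

* `hasDerivAt_val_mfderiv_localFrame_chartLine`, `fderiv_inducedMetric_localFrame_comp_symm` —
  compatibility: `∂_d G_{ab} = g(D̄_d(df ∂ₐ), df ∂_b) + g(D̄_d(df ∂_b), df ∂ₐ)`
  (`hasDerivAt_val_apply_along` along the image curve);
* `covariantDerivAlong_mfderiv_localFrame_chartLine_comm` — torsion-freeness:
  `D̄_d(df ∂ₐ) = D̄ₐ(df ∂_d)` at every point of the chart domain (`x_{ts} = x_{st}`,
  `covariantDerivAlong_velocity_comm`, for the image of the coordinate rectangle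
  `(t, s) ↦ φ⁻¹(φ p + t e_d + s eₐ)`);

with the bookkeeping of chart-straight lines in a FIXED chart (`contMDiffAt_chartLine`,
`contMDiffAt_chartRect`, `velocity_chartLine`: the velocity of `t ↦ φ⁻¹(z + t w)` is `∑ w^d ∂_d`,
`tangentLift_comp_chartLine`, `velocity_comp`). Working in the chart at `y₀` rather than at the
moving point is what makes the identity usable along the coordinate lines near `y₀` (as needed to
differentiate it once more in the proof of the Gauss equation).

Everything is proved; there are no definitions and no named facts.

## References

* B. O'Neill, *Semi-Riemannian geometry with applications to relativity*, Academic Press 1983,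
  Ch. 4, Lemma 1, Cor. 2, Lemma 3, Lemma 4, Prop. 8 (pp. 97–105), Prop. 44 (p. 123); Ch. 3,
  Thm. 3.11, Prop. 3.13 (Koszul formula).
-/

noncomputable section

open Bundle Set Filter Function Manifold
open scoped Manifold ContDiff Topology

namespace Literature.Geometry.Lorentzian

variable {E : Type*} [NormedAddCommGroup E] [NormedSpace ℝ E] {H : Type*} [TopologicalSpace H]
  {I : ModelWithCorners ℝ E H} {M : Type*} [TopologicalSpace M] [ChartedSpace H M]
  [IsManifold I ∞ M]
  {E' : Type*} [NormedAddCommGroup E'] [NormedSpace ℝ E'] {H' : Type*} [TopologicalSpace H']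
  {I' : ModelWithCorners ℝ E' H'} {N : Type*} [TopologicalSpace N] [ChartedSpace H' N]
  [IsManifold I' ∞ N]

/-! ### Chart-straight lines and coordinate rectangles in a fixed chart -/

section ChartLine

variable [I'.Boundaryless] {y₀ : N}

omit [IsManifold I ∞ M] in
/-- The chart-straight line `t ↦ φ⁻¹(z + t w)` of the extended chart `φ` at `y₀` through a point
`z` of the chart target is `C^∞` at `t = 0` (boundaryless model: the inverse extended chart is
`C^∞` on the open target). O'Neill 1983, Ch. 1, proof of Prop. 1.16 (coordinate curves).
[folklore] -/
theorem contMDiffAt_chartLine {z : E'} (hz : z ∈ (extChartAt I' y₀).target) (w : E') :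
    ContMDiffAt 𝓘(ℝ, ℝ) I' ∞ (fun t : ℝ ↦ (extChartAt I' y₀).symm (z + t • w)) 0 := by
  have h1 : ContMDiffAt 𝓘(ℝ, E') I' ∞ (extChartAt I' y₀).symm (z + (0 : ℝ) • w) := by
    rw [zero_smul, add_zero]
    exact (contMDiffOn_extChartAt_symm y₀).contMDiffAt ((isOpen_extChartAt_target y₀).mem_nhds hz)
  have h2 : ContMDiff 𝓘(ℝ, ℝ) 𝓘(ℝ, E') ∞ (fun t : ℝ ↦ z + t • w) :=
    (contDiff_const.add (contDiff_id.smul contDiff_const)).contMDiff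
  exact h1.comp 0 h2.contMDiffAt

omit [IsManifold I ∞ M] in
/-- The coordinate rectangle `(t, s) ↦ φ⁻¹(z + t u + s v)` of the extended chart at `y₀` through a
point `z` of the chart target is a `C^∞` two-parameter map at `(0, 0)`. [folklore] -/
theorem contMDiffAt_chartRect {z : E'} (hz : z ∈ (extChartAt I' y₀).target) (u v : E') :
    ContMDiffAt (𝓘(ℝ, ℝ).prod 𝓘(ℝ, ℝ)) I' ∞
      (uncurry fun t s : ℝ ↦ (extChartAt I' y₀).symm (z + t • u + s • v)) (0, 0) := by
  have h1 : ContMDiffAt 𝓘(ℝ, E') I' ∞ (extChartAt I' y₀).symm (z + (0 : ℝ) • u + (0 : ℝ) • v) := by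
    rw [zero_smul, zero_smul, add_zero, add_zero]
    exact (contMDiffOn_extChartAt_symm y₀).contMDiffAt ((isOpen_extChartAt_target y₀).mem_nhds hz)
  have h2 : ContMDiff (𝓘(ℝ, ℝ).prod 𝓘(ℝ, ℝ)) 𝓘(ℝ, E') ∞
      (uncurry fun t s : ℝ ↦ z + t • u + s • v) :=
    (contMDiff_const.add (contMDiff_fst.smul contMDiff_const)).add
      (contMDiff_snd.smul contMDiff_const)
  exact h1.comp (0, 0) h2.contMDiffAt

/-- **Velocity of a chart-straight line.** The velocity at `t = 0` of `t ↦ φ⁻¹(z + t w)` is the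
frame combination `∑_d w^d ∂_d` at `φ⁻¹ z` (`∂_d` the coordinate frame of the chart at `y₀`,
`w^d` the coordinates of `w` in the basis `b'`): its chart expression is `t ↦ z + t w` near `0`.
O'Neill 1983, Ch. 1, Prop. 1.16 and Ch. 4, p. 122 (`x_u = ∑ ∂xⁱ/∂u ∂ᵢ`).
[cite: ONeill1983, Ch. 4, p. 122] -/
theorem velocity_chartLine {ι : Type*} [Fintype ι] (b' : Module.Basis ι ℝ E') {z : E'}
    (hz : z ∈ (extChartAt I' y₀).target) (w : E') :
    velocity I' (fun t : ℝ ↦ (extChartAt I' y₀).symm (z + t • w)) 0 =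
      ∑ d, b'.coord d w • (trivializationAt E' (TangentSpace I') y₀).localFrame b' d
        ((extChartAt I' y₀).symm z) := by
  have hsrc : (extChartAt I' y₀).symm z ∈ (chartAt H' y₀).source := by
    rw [← extChartAt_source I']; exact (extChartAt I' y₀).map_target hz
  have hγ := (contMDiffAt_chartLine (y₀ := y₀) hz w).mdifferentiableAt (by simp)
  have h0 : (fun t : ℝ ↦ (extChartAt I' y₀).symm (z + t • w)) 0 = (extChartAt I' y₀).symm z := by
    simp
  have hsrc' : (extChartAt I' y₀).symm (z + (0 : ℝ) • w) ∈ (chartAt H' y₀).source := by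
    rw [zero_smul, add_zero]; exact hsrc
  have h1 := hasDerivAt_extChartAt_comp (x₁ := y₀) hγ hsrc'
  -- the chart expression is `t ↦ z + t w` near `0`
  have hev : (extChartAt I' y₀ ∘ fun t : ℝ ↦ (extChartAt I' y₀).symm (z + t • w)) =ᶠ[𝓝 0]
      fun t : ℝ ↦ z + t • w := by
    have hc : Continuous fun t : ℝ ↦ z + t • w := by fun_prop
    have hmem : ∀ᶠ t : ℝ in 𝓝 0, z + t • w ∈ (extChartAt I' y₀).target :=
      hc.continuousAt.preimage_mem_nhds (by simpa using (isOpen_extChartAt_target y₀).mem_nhds hz)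
    filter_upwards [hmem] with t ht
    exact (extChartAt I' y₀).right_inv ht
  have h2 :
      HasDerivAt (extChartAt I' y₀ ∘ fun t : ℝ ↦ (extChartAt I' y₀).symm (z + t • w)) w 0 := by
    refine HasDerivAt.congr_of_eventuallyEq ?_ hev
    simpa using ((hasDerivAt_id (0 : ℝ)).smul_const w).const_add z
  have hA : (trivializationAt E' (TangentSpace I') y₀ ⟨(extChartAt I' y₀).symm z,
      velocity I' (fun t : ℝ ↦ (extChartAt I' y₀).symm (z + t • w)) 0⟩).2 = w := by
    have h1' := h1.deriv
    rw [h2.deriv, zero_smul, add_zero] at h1'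
    exact h1'.symm
  have key := sum_coord_smul_localFrame_eq (I := I') b' hsrc
    (velocity I' (fun t : ℝ ↦ (extChartAt I' y₀).symm (z + t • w)) 0)
  rw [Trivialization.continuousLinearMapAt_apply_of_mem ℝ _ (by simpa using hsrc), hA] at key
  exact key.symm

end ChartLine


/-! ### Velocities of curves through a map -/

section Comp

omit [IsManifold I ∞ M] [IsManifold I' ∞ N] in
/-- Chain rule for velocities: `(f ∘ γ)'(t) = df_{γ t}(γ' t)`. [folklore] -/
theorem velocity_comp {f : N → M} {γ : ℝ → N} {t : ℝ} (hf : MDifferentiableAt I' I f (γ t))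
    (hγ : MDifferentiableAt 𝓘(ℝ, ℝ) I' γ t) :
    velocity I (f ∘ γ) t = mfderiv I' I f (γ t) (velocity I' γ t) := by
  simp only [velocity]
  rw [mfderiv_comp t hf hγ]
  rfl

omit [IsManifold I ∞ M] [IsManifold I' ∞ N] in
/-- `∑_d (b' a)^d v_d = v_a` for the coordinate functionals of a basis. [folklore] -/
theorem sum_coord_basis_smul {ι : Type*} [Fintype ι] [DecidableEq ι] (b' : Module.Basis ι ℝ E')
    {V : Type*} [AddCommGroup V] [Module ℝ V] (v : ι → V) (a : ι) :
    ∑ d, b'.coord d (b' a) • v d = v a := by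
  simp only [Module.Basis.coord_apply, Module.Basis.repr_self, Finsupp.single_apply]
  simp [Finset.sum_ite_eq]

variable [I'.Boundaryless] {y₀ : N}

omit [IsManifold I ∞ M] in
/-- **Tangent lift of the image of a chart-straight line**: for `f` differentiable at `φ⁻¹ z`, the
tangent lift at `0` of `s ↦ f(φ⁻¹(z + s w))` is `(f(φ⁻¹ z), df(∑_d w^d ∂_d))` (`velocity_comp`,
`velocity_chartLine`; stated in `TM` to keep both sides in one fibre). O'Neill 1983, Ch. 4,
p. 122. [cite: ONeill1983, Ch. 4, p. 122] -/
theorem tangentLift_comp_chartLine {ι : Type*} [Fintype ι] (b' : Module.Basis ι ℝ E') {f : N → M}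
    {z : E'} (hz : z ∈ (extChartAt I' y₀).target)
    (hf : MDifferentiableAt I' I f ((extChartAt I' y₀).symm z)) (w : E') :
    tangentLift I (fun s : ℝ ↦ f ((extChartAt I' y₀).symm (z + s • w))) 0 =
      TotalSpace.mk' E (f ((extChartAt I' y₀).symm z)) (mfderiv I' I f ((extChartAt I' y₀).symm z)
        (∑ d, b'.coord d w • (trivializationAt E' (TangentSpace I') y₀).localFrame b' d
          ((extChartAt I' y₀).symm z))) := by
  have hγ := (contMDiffAt_chartLine (y₀ := y₀) hz w).mdifferentiableAt (by simp)
  have hz0 : z + (0 : ℝ) • w = z := by rw [zero_smul, add_zero]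
  have hf' : MDifferentiableAt I' I f ((fun s : ℝ ↦ (extChartAt I' y₀).symm (z + s • w)) 0) := by
    show MDifferentiableAt I' I f ((extChartAt I' y₀).symm (z + (0 : ℝ) • w))
    rw [hz0]; exact hf
  have h := velocity_comp (I := I) (I' := I') hf' hγ
  have hv := velocity_chartLine (y₀ := y₀) b' hz w
  unfold tangentLift
  change TotalSpace.mk' E (f ((extChartAt I' y₀).symm (z + (0 : ℝ) • w)))
    (velocity I (f ∘ fun s : ℝ ↦ (extChartAt I' y₀).symm (z + s • w)) 0) = _
  rw [h, hv, hz0]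

end Comp

/-! ### The ambient covariant derivative of `df(∂ₐ)` along coordinate lines -/

section Tangential

variable [FiniteDimensional ℝ E] [CompleteSpace E]
  (g : PseudoRiemannianMetric I ∞ E (TangentSpace I : M → Type _)) [g.HasLeviCivita]
  [FiniteDimensional ℝ E'] [I'.Boundaryless] {f : N → M}
  {ι : Type*} [Fintype ι] [DecidableEq ι] (b' : Module.Basis ι ℝ E') {y₀ : N}

omit [IsManifold I' ∞ N] [FiniteDimensional ℝ E'] [I'.Boundaryless] in
/-- For `p` in the chart domain of `y₀`, `φ p` lies in the chart target. [folklore] -/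
theorem extChartAt_mem_target_of_mem_source {p : N} (hp : p ∈ (chartAt H' y₀).source) :
    extChartAt I' y₀ p ∈ (extChartAt I' y₀).target :=
  (extChartAt I' y₀).map_source (by rwa [extChartAt_source])

omit [FiniteDimensional ℝ E'] in
/-- **Symmetry `D_{∂_d}(df ∂ₐ) = D_{∂ₐ}(df ∂_d)` along coordinate lines.** For `f : N → M` of
class `C²`, `p` in the chart domain of `y₀` (chart `φ`, coordinate frame `∂ₐ`): the covariant
derivative at `0`, along the image `t ↦ f(φ⁻¹(φ p + t e_d))` of the `d`-th coordinate line through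
`p`, of the field `df(∂ₐ)` equals the same with `d` and `a` exchanged — `x_{ts} = x_{st}`
(`covariantDerivAlong_velocity_comm`, torsion-freeness) for the two-parameter map
`(t, s) ↦ f(φ⁻¹(φ p + t e_d + s eₐ))`, whose partial velocities are `df(∂_d)`, `df(∂ₐ)`
(`velocity_comp_chartLine`). O'Neill 1983, Ch. 4, Prop. 44 (1) with Lemma 4.4 (symmetry of
`II`). [cite: ONeill1983, Ch. 4, Prop. 44 (1)] -/
theorem covariantDerivAlong_mfderiv_localFrame_chartLine_comm (hf : ContMDiff I' I 2 f) {p : N}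
    (hp : p ∈ (chartAt H' y₀).source) (d a : ι) :
    covariantDerivAlong g.leviCivita
        (fun t : ℝ ↦ f ((extChartAt I' y₀).symm (extChartAt I' y₀ p + t • b' d)))
        (fun t ↦ mfderiv I' I f ((extChartAt I' y₀).symm (extChartAt I' y₀ p + t • b' d))
          ((trivializationAt E' (TangentSpace I') y₀).localFrame b' a
            ((extChartAt I' y₀).symm (extChartAt I' y₀ p + t • b' d)))) 0 =
      covariantDerivAlong g.leviCivita
        (fun s : ℝ ↦ f ((extChartAt I' y₀).symm (extChartAt I' y₀ p + s • b' a)))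
        (fun s ↦ mfderiv I' I f ((extChartAt I' y₀).symm (extChartAt I' y₀ p + s • b' a))
          ((trivializationAt E' (TangentSpace I') y₀).localFrame b' d
            ((extChartAt I' y₀).symm (extChartAt I' y₀ p + s • b' a)))) 0 := by
  have hz := extChartAt_mem_target_of_mem_source (I' := I') hp
  have htors : g.leviCivita.torsion = 0 :=
    (PseudoRiemannianMetric.isLeviCivita_leviCivita_holds (g := g)).1
  have hx : ContMDiffAt (𝓘(ℝ, ℝ).prod 𝓘(ℝ, ℝ)) I 2 (uncurry fun t s : ℝ ↦
      f ((extChartAt I' y₀).symm (extChartAt I' y₀ p + t • b' d + s • b' a))) (0, 0) :=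
    (hf.contMDiffAt.comp (0, 0) ((contMDiffAt_chartRect hz (b' d) (b' a)).of_le
      (by exact WithTop.coe_le_coe.2 le_top)))
  have hsym := covariantDerivAlong_velocity_comm g.leviCivita htors hx
  -- points of the lines stay in the chart target near `0`
  have hmem : ∀ w : E', ∀ᶠ t : ℝ in 𝓝 0,
      extChartAt I' y₀ p + t • w ∈ (extChartAt I' y₀).target := fun w ↦ by
    have hc : Continuous fun t : ℝ ↦ extChartAt I' y₀ p + t • w := by fun_prop
    exact hc.continuousAt.preimage_mem_nhds
      (by simpa using (isOpen_extChartAt_target y₀).mem_nhds hz)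
  have hfd : ∀ z, MDifferentiableAt I' I f z := hf.mdifferentiable two_ne_zero
  -- the left-hand sides agree
  have hL : (fun t : ℝ ↦ (TotalSpace.mk' E
      ((fun t : ℝ ↦ (fun t s : ℝ ↦ f ((extChartAt I' y₀).symm
        (extChartAt I' y₀ p + t • b' d + s • b' a))) t 0) t)
      (velocity I ((fun t s : ℝ ↦ f ((extChartAt I' y₀).symm
        (extChartAt I' y₀ p + t • b' d + s • b' a))) t) 0) : TangentBundle I M)) =ᶠ[𝓝 0]
      fun t ↦ (TotalSpace.mk' E
        (f ((extChartAt I' y₀).symm (extChartAt I' y₀ p + t • b' d)))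
        (mfderiv I' I f ((extChartAt I' y₀).symm (extChartAt I' y₀ p + t • b' d))
          ((trivializationAt E' (TangentSpace I') y₀).localFrame b' a
            ((extChartAt I' y₀).symm (extChartAt I' y₀ p + t • b' d)))) : TangentBundle I M) := by
    filter_upwards [hmem (b' d)] with t ht
    change tangentLift I (fun s : ℝ ↦ f ((extChartAt I' y₀).symm
      (extChartAt I' y₀ p + t • b' d + s • b' a))) 0 = _
    rw [tangentLift_comp_chartLine b' ht (hfd _) (b' a), sum_coord_basis_smul]
  have hR : (fun s : ℝ ↦ (TotalSpace.mk' E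
      ((fun t s : ℝ ↦ f ((extChartAt I' y₀).symm
        (extChartAt I' y₀ p + t • b' d + s • b' a))) 0 s)
      (velocity I (fun t ↦ (fun t s : ℝ ↦ f ((extChartAt I' y₀).symm
        (extChartAt I' y₀ p + t • b' d + s • b' a))) t s) 0) : TangentBundle I M)) =ᶠ[𝓝 0]
      fun s ↦ (TotalSpace.mk' E
        (f ((extChartAt I' y₀).symm (extChartAt I' y₀ p + s • b' a)))
        (mfderiv I' I f ((extChartAt I' y₀).symm (extChartAt I' y₀ p + s • b' a))
          ((trivializationAt E' (TangentSpace I') y₀).localFrame b' d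
            ((extChartAt I' y₀).symm (extChartAt I' y₀ p + s • b' a)))) : TangentBundle I M) := by
    filter_upwards [hmem (b' a)] with s hs
    have hswap : (fun t : ℝ ↦ f ((extChartAt I' y₀).symm
        (extChartAt I' y₀ p + t • b' d + s • b' a))) =
        fun t : ℝ ↦ f ((extChartAt I' y₀).symm (extChartAt I' y₀ p + s • b' a + t • b' d)) := by
      funext t; rw [add_right_comm]
    change tangentLift I (fun t : ℝ ↦ f ((extChartAt I' y₀).symm
      (extChartAt I' y₀ p + t • b' d + s • b' a))) 0 = _
    rw [hswap, tangentLift_comp_chartLine b' hs (hfd _) (b' d), sum_coord_basis_smul]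
  exact (covariantDerivAlong_congr_of_eventuallyEq g.leviCivita hL).symm.trans
    (hsym.trans (covariantDerivAlong_congr_of_eventuallyEq g.leviCivita hR))


omit [IsManifold I' ∞ N] [FiniteDimensional ℝ E'] [I'.Boundaryless] [CompleteSpace E]
  [FiniteDimensional ℝ E] [g.HasLeviCivita] [Fintype ι] [DecidableEq ι] in
/-- For `p` in the chart domain of `y₀`, `φ⁻¹(φ p + 0 • w) = p`. [folklore] -/
theorem extChartAt_symm_apply_add_zero_smul {p : N} (hp : p ∈ (chartAt H' y₀).source) (w : E') :
    (extChartAt I' y₀).symm (extChartAt I' y₀ p + (0 : ℝ) • w) = p := by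
  rw [zero_smul, add_zero]
  exact (extChartAt I' y₀).left_inv (by rwa [extChartAt_source])

omit [FiniteDimensional ℝ E'] [Fintype ι] [DecidableEq ι] in
/-- **Metric compatibility along a coordinate line, for the fields `df(∂ₐ)`, `df(∂_b)`.** For
`f : N → M` of class `C²` and `p` in the chart domain of `y₀`, the function
`t ↦ g(df ∂ₐ, df ∂_b)(φ⁻¹(φ p + t e_d))` — the induced metric coefficient `(f^*g)_{ab}` along the
`d`-th coordinate line through `p` — has derivative
`g(D_{∂_d}(df ∂ₐ), df ∂_b) + g(df ∂ₐ, D_{∂_d}(df ∂_b))` at `t = 0`, the covariant derivatives being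
taken along the image curve in `M` (`hasDerivAt_val_apply_along`: compatibility of the
Levi-Civita connection of `g`). O'Neill 1983, Ch. 4, Cor. 4.2 (5) and proof of Lemma 4.3.
[cite: ONeill1983, Ch. 4, Cor. 4.2 (5)] -/
theorem hasDerivAt_val_mfderiv_localFrame_chartLine (hf : ContMDiff I' I 2 f) {p : N}
    (hp : p ∈ (chartAt H' y₀).source) (d a b : ι) :
    HasDerivAt (fun t : ℝ ↦ g.val (f ((extChartAt I' y₀).symm (extChartAt I' y₀ p + t • b' d)))
        (mfderiv I' I f ((extChartAt I' y₀).symm (extChartAt I' y₀ p + t • b' d))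
          ((trivializationAt E' (TangentSpace I') y₀).localFrame b' a
            ((extChartAt I' y₀).symm (extChartAt I' y₀ p + t • b' d))))
        (mfderiv I' I f ((extChartAt I' y₀).symm (extChartAt I' y₀ p + t • b' d))
          ((trivializationAt E' (TangentSpace I') y₀).localFrame b' b
            ((extChartAt I' y₀).symm (extChartAt I' y₀ p + t • b' d)))))
      (g.val (f p)
          (covariantDerivAlong g.leviCivita
            (fun t : ℝ ↦ f ((extChartAt I' y₀).symm (extChartAt I' y₀ p + t • b' d)))
            (fun t ↦ mfderiv I' I f ((extChartAt I' y₀).symm (extChartAt I' y₀ p + t • b' d))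
              ((trivializationAt E' (TangentSpace I') y₀).localFrame b' a
                ((extChartAt I' y₀).symm (extChartAt I' y₀ p + t • b' d)))) 0)
          (mfderiv I' I f p ((trivializationAt E' (TangentSpace I') y₀).localFrame b' b p)) +
        g.val (f p)
          (mfderiv I' I f p ((trivializationAt E' (TangentSpace I') y₀).localFrame b' a p))
          (covariantDerivAlong g.leviCivita
            (fun t : ℝ ↦ f ((extChartAt I' y₀).symm (extChartAt I' y₀ p + t • b' d)))
            (fun t ↦ mfderiv I' I f ((extChartAt I' y₀).symm (extChartAt I' y₀ p + t • b' d))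
              ((trivializationAt E' (TangentSpace I') y₀).localFrame b' b
                ((extChartAt I' y₀).symm (extChartAt I' y₀ p + t • b' d)))) 0)) 0 := by
  have hcompat := (PseudoRiemannianMetric.isLeviCivita_leviCivita_holds (g := g)).2
  have hz := extChartAt_mem_target_of_mem_source (I' := I') hp
  have hp0 := extChartAt_symm_apply_add_zero_smul (I' := I') hp (b' d)
  have hI'1 : IsManifold I' (1 + 1) N := inferInstanceAs (IsManifold I' 2 N)
  have hVB' : ContMDiffVectorBundle 1 E' (TangentSpace I' : N → Type _) I' :=
    TangentBundle.contMDiffVectorBundle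
  have hsd : ∀ e, MDiffAt (T% ((trivializationAt E' (TangentSpace I') y₀).localFrame b' e))
      ((extChartAt I' y₀).symm (extChartAt I' y₀ p + (0 : ℝ) • b' d)) := by
    rw [hp0]
    exact fun e ↦ (contMDiffAt_localFrame_of_mem 1 _ b' e (by simpa using hp)).mdifferentiableAt
      one_ne_zero
  have hγ : MDifferentiableAt 𝓘(ℝ, ℝ) I'
      (fun t : ℝ ↦ (extChartAt I' y₀).symm (extChartAt I' y₀ p + t • b' d)) 0 :=
    (contMDiffAt_chartLine hz _).mdifferentiableAt (by simp)
  have hlift : ∀ e, MDifferentiableAt 𝓘(ℝ, ℝ) I.tangent (fun t : ℝ ↦ (TotalSpace.mk' E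
      (f ((extChartAt I' y₀).symm (extChartAt I' y₀ p + t • b' d)))
      (mfderiv I' I f ((extChartAt I' y₀).symm (extChartAt I' y₀ p + t • b' d))
        ((trivializationAt E' (TangentSpace I') y₀).localFrame b' e
          ((extChartAt I' y₀).symm (extChartAt I' y₀ p + t • b' d)))) : TangentBundle I M)) 0 :=
    fun e ↦ mdifferentiableAt_lift_comp_curve (I := I) (f := f)
      (Y := fun z ↦ mfderiv I' I f z ((trivializationAt E' (TangentSpace I') y₀).localFrame b' e z))
      (c := fun t : ℝ ↦ (extChartAt I' y₀).symm (extChartAt I' y₀ p + t • b' d)) hγ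
      (mdifferentiableAt_lift_mfderiv hf (hsd e))
  have h := g.hasDerivAt_val_apply_along hcompat
    (γ := fun t : ℝ ↦ f ((extChartAt I' y₀).symm (extChartAt I' y₀ p + t • b' d)))
    (V := fun t ↦ mfderiv I' I f ((extChartAt I' y₀).symm (extChartAt I' y₀ p + t • b' d))
      ((trivializationAt E' (TangentSpace I') y₀).localFrame b' a
        ((extChartAt I' y₀).symm (extChartAt I' y₀ p + t • b' d))))
    (W := fun t ↦ mfderiv I' I f ((extChartAt I' y₀).symm (extChartAt I' y₀ p + t • b' d))
      ((trivializationAt E' (TangentSpace I') y₀).localFrame b' b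
        ((extChartAt I' y₀).symm (extChartAt I' y₀ p + t • b' d)))) (t₀ := 0) (hlift a) (hlift b)
  -- move the base point `φ⁻¹(φ p + 0 • e_d)` to `p`
  have key : ∀ q : N, q = p → ∀ W₁ W₂ : E,
      g.val (f q) W₁
          (mfderiv I' I f q ((trivializationAt E' (TangentSpace I') y₀).localFrame b' b q))
        + g.val (f q) (mfderiv I' I f q
          ((trivializationAt E' (TangentSpace I') y₀).localFrame b' a q)) W₂ =
      g.val (f p) W₁
          (mfderiv I' I f p ((trivializationAt E' (TangentSpace I') y₀).localFrame b' b p))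
        + g.val (f p) (mfderiv I' I f p
          ((trivializationAt E' (TangentSpace I') y₀).localFrame b' a p)) W₂ := by
    rintro q rfl W₁ W₂; rfl
  exact h.congr_deriv (key _ hp0 _ _)

variable (hpb : PseudoRiemannianMetric.contMDiff_pullbackBilin I M I' N ∞)
  (hfi : g.IsSpacelikeImmersion I' f)

omit [Fintype ι] [DecidableEq ι] in
/-- **The coordinate derivative of the induced metric coefficients**: with
`G_{ab} = (f^*g)(∂ₐ, ∂_b)` read through the inverse chart at `y₀`,
`∂_d G_{ab}(φ p) = g(D_{∂_d}(df ∂ₐ), df ∂_b) + g(D_{∂_d}(df ∂_b), df ∂ₐ)`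
(`hasDerivAt_val_mfderiv_localFrame_chartLine` and the chain rule along the straight line
`t ↦ φ p + t e_d`, on which the chart representative is `C^∞`,
`contDiffOn_gram_comp_extChartAt_symm`). O'Neill 1983, Ch. 4, proof of Lemma 4.3.
[cite: ONeill1983, Ch. 4, Lemma 4.3] -/
theorem fderiv_inducedMetric_localFrame_comp_symm {p : N} (hp : p ∈ (chartAt H' y₀).source)
    (d a b : ι) :
    fderiv ℝ (fun z ↦ (g.inducedMetric f hpb hfi).val ((extChartAt I' y₀).symm z)
        ((trivializationAt E' (TangentSpace I') y₀).localFrame b' a ((extChartAt I' y₀).symm z))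
        ((trivializationAt E' (TangentSpace I') y₀).localFrame b' b ((extChartAt I' y₀).symm z)))
      (extChartAt I' y₀ p) (b' d) =
      g.val (f p)
          (covariantDerivAlong g.leviCivita
            (fun t : ℝ ↦ f ((extChartAt I' y₀).symm (extChartAt I' y₀ p + t • b' d)))
            (fun t ↦ mfderiv I' I f ((extChartAt I' y₀).symm (extChartAt I' y₀ p + t • b' d))
              ((trivializationAt E' (TangentSpace I') y₀).localFrame b' a
                ((extChartAt I' y₀).symm (extChartAt I' y₀ p + t • b' d)))) 0)
          (mfderiv I' I f p ((trivializationAt E' (TangentSpace I') y₀).localFrame b' b p)) +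
        g.val (f p)
          (covariantDerivAlong g.leviCivita
            (fun t : ℝ ↦ f ((extChartAt I' y₀).symm (extChartAt I' y₀ p + t • b' d)))
            (fun t ↦ mfderiv I' I f ((extChartAt I' y₀).symm (extChartAt I' y₀ p + t • b' d))
              ((trivializationAt E' (TangentSpace I') y₀).localFrame b' b
                ((extChartAt I' y₀).symm (extChartAt I' y₀ p + t • b' d)))) 0)
          (mfderiv I' I f p ((trivializationAt E' (TangentSpace I') y₀).localFrame b' a p)) := by
  have hf : ContMDiff I' I 2 f :=
    (PseudoRiemannianMetric.IsSpacelikeImmersion.contMDiff_self hfi).of_le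
      (by exact WithTop.coe_le_coe.2 le_top)
  have hz := extChartAt_mem_target_of_mem_source (I' := I') hp
  have hGd : DifferentiableAt ℝ (fun z ↦ (g.inducedMetric f hpb hfi).val ((extChartAt I' y₀).symm z)
      ((trivializationAt E' (TangentSpace I') y₀).localFrame b' a ((extChartAt I' y₀).symm z))
      ((trivializationAt E' (TangentSpace I') y₀).localFrame b' b ((extChartAt I' y₀).symm z)))
      (extChartAt I' y₀ p) :=
    ((contDiffOn_gram_comp_extChartAt_symm b' (g.inducedMetric f hpb hfi) a b).differentiableOn
      (by simp)).differentiableAt ((isOpen_extChartAt_target y₀).mem_nhds hz)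
  have hline : HasDerivAt (fun t : ℝ ↦ extChartAt I' y₀ p + t • b' d) (b' d) 0 := by
    simpa using ((hasDerivAt_id (0 : ℝ)).smul_const (b' d)).const_add (extChartAt I' y₀ p)
  have hcomp := hGd.hasFDerivAt.comp_hasDerivAt_of_eq (hf := hline)
    (hy := by rw [zero_smul, add_zero])
  rw [hcomp.unique (hasDerivAt_val_mfderiv_localFrame_chartLine g b' hf hp d a b),
    g.symm (f p) (mfderiv I' I f p ((trivializationAt E' (TangentSpace I') y₀).localFrame b' a p))]


/-- **The Gauss formula, tangential part, on coordinate fields** (O'Neill 1983, Ch. 4, Lemma 3: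
`D_V W = tan D̄_V W` for the Levi-Civita connection `D` of a semi-Riemannian submanifold and the
ambient connection `D̄`, proved from the Koszul formula; Prop. 8 for fields along curves). For a
smooth spacelike immersion `f : (N, f^*g) → (M, g)`, `p` in the chart domain of `y₀` with
coordinate frame `∂ₐ` and coordinate lines `t ↦ φ⁻¹(φ p + t e_d)`:
`g(D̄_{∂_d}(df ∂ₐ), df ∂_b)(p) = (f^*g)(∇_{∂_d} ∂ₐ, ∂_b)(p)`, where `D̄_{∂_d}(df ∂ₐ)` is the
covariant derivative of the field `df(∂ₐ)` along the image of the `d`-th coordinate line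
(Levi-Civita connection of `g`, `covariantDerivAlong`) and `∇` is the Levi-Civita connection of the
induced metric `f^*g`. Proof as printed: both sides satisfy the Koszul identity on coordinate
fields — `2(f^*g)(∇_{∂_d}∂ₐ, ∂_b) = ∂_d G_{ab} + ∂ₐ G_{bd} − ∂_b G_{da}`
(`two_mul_val_leviCivita_localFrame`), while `∂_d G_{ab} = g(D̄_d ∂ₐ, ∂_b) + g(D̄_d ∂_b, ∂ₐ)`
(compatibility, `fderiv_inducedMetric_localFrame_comp_symm`) and `D̄_d(df ∂ₐ) = D̄ₐ(df ∂_d)`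
(torsion-freeness, `covariantDerivAlong_mfderiv_localFrame_chartLine_comm`).
[cite: ONeill1983, Ch. 4, Lemma 3] -/
theorem val_covariantDerivAlong_mfderiv_localFrame_chartLine [CompleteSpace E'] {p : N}
    (hp : p ∈ (chartAt H' y₀).source) (d a b : ι) :
    haveI := (g.inducedMetric f hpb hfi).hasLeviCivita
    g.val (f p)
        (covariantDerivAlong g.leviCivita
          (fun t : ℝ ↦ f ((extChartAt I' y₀).symm (extChartAt I' y₀ p + t • b' d)))
          (fun t ↦ mfderiv I' I f ((extChartAt I' y₀).symm (extChartAt I' y₀ p + t • b' d))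
            ((trivializationAt E' (TangentSpace I') y₀).localFrame b' a
              ((extChartAt I' y₀).symm (extChartAt I' y₀ p + t • b' d)))) 0)
        (mfderiv I' I f p ((trivializationAt E' (TangentSpace I') y₀).localFrame b' b p)) =
      (g.inducedMetric f hpb hfi).val p
        ((g.inducedMetric f hpb hfi).leviCivita
          ((trivializationAt E' (TangentSpace I') y₀).localFrame b' a) p
          ((trivializationAt E' (TangentSpace I') y₀).localFrame b' d p))
        ((trivializationAt E' (TangentSpace I') y₀).localFrame b' b p) := by
  haveI := (g.inducedMetric f hpb hfi).hasLeviCivita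
  have hf : ContMDiff I' I 2 f :=
    (PseudoRiemannianMetric.IsSpacelikeImmersion.contMDiff_self hfi).of_le
      (by exact WithTop.coe_le_coe.2 le_top)
  have hK := two_mul_val_leviCivita_localFrame (g := g.inducedMetric f hpb hfi) b' hp
    (Gh := fun z i j ↦ (g.inducedMetric f hpb hfi).val ((extChartAt I' y₀).symm z)
      ((trivializationAt E' (TangentSpace I') y₀).localFrame b' i ((extChartAt I' y₀).symm z))
      ((trivializationAt E' (TangentSpace I') y₀).localFrame b' j ((extChartAt I' y₀).symm z)))
    (Filter.Eventually.of_forall fun z i j ↦ rfl) d a b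
  rw [fderiv_inducedMetric_localFrame_comp_symm g b' hpb hfi hp d a b,
    fderiv_inducedMetric_localFrame_comp_symm g b' hpb hfi hp a b d,
    fderiv_inducedMetric_localFrame_comp_symm g b' hpb hfi hp b d a,
    ← covariantDerivAlong_mfderiv_localFrame_chartLine_comm g b' hf hp d a,
    ← covariantDerivAlong_mfderiv_localFrame_chartLine_comm g b' hf hp d b,
    ← covariantDerivAlong_mfderiv_localFrame_chartLine_comm g b' hf hp a b] at hK
  linarith

end Tangential

end Literature.Geometry.Lorentzian

end
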